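import Summits.ResolutionOfSingularities.ResolutionOfSingularities.Theses.EquisingularLift
import Summits.ResolutionOfSingularities.ResolutionOfSingularities.Theorems.EquisingularLiftCampaignW45bEquisingularLiftNatInstantiation
import HarnessLib

/-!
# Support item `EquisingularLiftOfNat` (stmt-ResolutionOfSingularities-19887): `EquisingularLiftNat → EquisingularLift`

Route `Theses/EquisingularLift.lean` (rev 3), crux chain w45b, slot W4.5(b) [OURS · L1]. The route decl
`Theses.EquisingularLift.EquisingularLiftOfNat` is by definition the implication
`EquisingularLiftNat → EquisingularLift`, and the route decl `Theses.EquisingularLift.EquisingularLiftNat`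
is definitionally `∀ p, Theorems.EquisingularLiftNat p` (typer res-L1-type-o1, p482511). The implication
itself was proved as `Theorems.equisingularLift_of_equisingularLiftNat` (res-L1-type-o1, p483238: the ONE
instantiation of the existential ambient of EL at `ℙⁿ_O` with `Y := range (ι ≫ Proj.map (MvPolynomial.map π))`,
director-resolution ruling 2026-08-27T00:46:45Z). This file is the one-line closer the chain planner
res-L1-w45b-plan-1 checked in `CloserCheck-rev3.lean` (evidence on the item) and asked a prover to file.

HONEST FRAMING. OURS bookkeeping inside the rescue branch of cell res-hironaka; it asserts nothing about any
manuscript and does not touch the crux `EquisingularLiftNat` (stmt-ResolutionOfSingularities-20038), which stays open.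
No `sorry`; axioms standard.
-/

set_option linter.dupNamespace false -- mandated namespace of this single-conjunct summit

namespace Summit.ResolutionOfSingularities.ResolutionOfSingularities.Theorems

/-- **Support item stmt-ResolutionOfSingularities-19887** `EquisingularLiftOfNat`: the natural-ambient crux
`EquisingularLiftNat` (EL♮, fixed ambient `ℙⁿ_O`, condition E1 on every centre) implies the original crux
`EquisingularLift` (EL, existential smooth proper ambient). One line over
`Theorems.equisingularLift_of_equisingularLiftNat` (p483238); the first step unfolds the route decl to
`EquisingularLiftNat → EquisingularLift`. [folklore] -/
theorem EquisingularLiftOfNat_proof : Theses.EquisingularLift.EquisingularLiftOfNat := by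
  unfold Theses.EquisingularLift.EquisingularLiftOfNat
  intro h
  exact equisingularLift_of_equisingularLiftNat fun p => h p

end Summit.ResolutionOfSingularities.ResolutionOfSingularities.Theorems
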